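import Mathlib
import Summits.NavierStokesRegularity.NavierStokesRegularity.Theorems.WakeRatchetTailRatchetDyadicWaveStrict
import Summits.NavierStokesRegularity.NavierStokesRegularity.Theorems.WakeRatchetNoBackwardDSS
import HarnessLib

/-!
# The registered rung `stub_rung_dss` ON THE DYADIC MEMBER is exactly `¬ DyadicScalarFronts`

The plan-only BC5 rung `stub_rung_dss` of the registered line `birth` of stmt-NavierStokesRegularity-21808
(`WakeRatchet.TailRatchet`) asks for the uniform-fraction tail ratchet along every uniformly bounded admissible
INVISCID eternal solution that is SHELL-SELF-SIMILAR, `W_{n+1}(σ) = W_n(σ − T)`, on every E₂(R) table.  This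
file settles its logical status on the home table of the construction item: restricted to the dyadic member
`dyadicTable ∈ E₂(2)`, the rung HOLDS IF AND ONLY IF the construction `DyadicScalarFronts` FAILS
(`dyadicRung_iff_not_DyadicScalarFronts`).

Ingredients: (i) a shell-self-similar admissible eternal solution with positive lag `T` is the `dssEmbed` of
the single-profile DSS wave `Φ = W_0` (`isDSSWave_of_shellSelfSimilar`, any table), and with non-positive lag
it vanishes (tree `eq_zero_of_dss_nonpos_lag`); (ii) on the dyadic member single-profile DSS waves are exactly
scalar fronts (`WakeRatchetDyadicWaveStrict`); (iii) the contraction kills every positive-lag self-similar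
solution below the threshold `(1+ε₀)^5(1−w) ≤ 1` (tree `trivial_of_contraction`).  So: fronts at arbitrarily
small `ε₀` refute the dyadic rung; and if below some `ε` there are none, every shell-self-similar bounded
admissible eternal solution of the dyadic member below `ε` is ZERO, and the rung holds there vacuously (with any
`w`, e.g. `w = 1/2`).  In particular the dyadic rung is never true «with content»: it is a Liouville statement.

HONEST FRAMING: bookkeeping about a MODEL lattice ODE (Tao 2016 §1.2, §4); nothing here concerns the
Navier–Stokes equations; no item is closed (the full rung quantifies over all E₂(R) tables; by
`WakeRatchetBirthStubs.stubRungDss_false_of_DyadicScalarFronts` it is false if `DyadicScalarFronts` holds).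
-/

noncomputable section

set_option linter.dupNamespace false

namespace Summit.NavierStokesRegularity.NavierStokesRegularity.Theorems

namespace WakeRatchetDyadicRung

open Filter Topology Set MeasureTheory
open Literature.Analysis.FluidPDE Literature.Analysis.FluidPDE.TaoCascade
open WakeRatchetDyadicFront WakeRatchetDSS WakeRatchetDyadicWaveStrict

variable {m : ℕ} {ε₀ : ℝ}

/-- Iterating the shell self-similarity: `W_{n+k}(σ) = W_n(σ − kT)`. [elementary] -/
theorem shift_iter {W : ℤ → ℝ → Em m} {T : ℝ} (hD : ∀ (n : ℤ) (σ : ℝ), W (n + 1) σ = W n (σ - T))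
    (k : ℕ) (n : ℤ) (σ : ℝ) : W (n + k) σ = W n (σ - k * T) := by
  induction k generalizing σ with
  | zero => simp
  | succ k ih =>
    have h1 : W (n + (k + 1 : ℕ)) σ = W (n + k) (σ - T) := by
      have := hD (n + k) σ
      push_cast at this ⊢
      rw [show n + ((k : ℤ) + 1) = n + k + 1 by ring]
      exact this
    rw [h1, ih]
    congr 1
    push_cast
    ring

/-- A shell-self-similar family whose shell `0` vanishes identically vanishes identically. [elementary] -/
theorem eq_zero_of_shell_zero {W : ℤ → ℝ → Em m} {T : ℝ}
    (hD : ∀ (n : ℤ) (σ : ℝ), W (n + 1) σ = W n (σ - T)) (h0 : ∀ σ, W 0 σ = 0) :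
    ∀ (n : ℤ) (σ : ℝ), W n σ = 0 := by
  intro n σ
  rcases Int.eq_nat_or_neg n with ⟨k, rfl | rfl⟩
  · have := shift_iter hD k 0 σ
    rw [zero_add] at this
    rw [this, h0]
  · have := shift_iter hD k (-(k : ℤ)) (σ + k * T)
    rw [neg_add_cancel, add_sub_cancel_right] at this
    rw [← this, h0]

/-- **A shell-self-similar admissible eternal solution with positive lag is a single-profile DSS wave**
(profile `W_0`, trivial shape permutation; any table).
[cite: Tao2016AveragedNS, §4 Lemma 4.1 (4.8), §6.4; cell vocabulary (`IsEternal`, `IsDSSWave`)] -/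
theorem isDSSWave_of_shellSelfSimilar {α : Fin m → Fin m → Fin m → ℤ × ℤ × ℤ → ℝ} {W : ℤ → ℝ → Em m}
    {T : ℝ} (hT : 0 < T) (hE : IsEternal ε₀ α W)
    (hD : ∀ (n : ℤ) (σ : ℝ), W (n + 1) σ = W n (σ - T)) :
    IsDSSWave ε₀ α (1 : Equiv.Perm (Fin 1)) T (fun _ => W 0) := by
  refine ⟨hT, ?_, ?_, ?_⟩
  · intro r x
    have h := hE.law 0 x
    have e1 : W (0 - 1) x = W 0 (x + T) := by
      have := hD (-1) (x + T)
      rw [show (-1 : ℤ) + 1 = 0 by norm_num, add_sub_cancel_right] at this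
      rw [show (0 : ℤ) - 1 = -1 by norm_num]
      exact this.symm
    have e2 : W (0 + 1) x = W 0 (x - T) := by
      have := hD 0 x
      rwa [zero_add] at this ⊢
    rw [e1, e2] at h
    simpa using h
  · obtain ⟨M, hM⟩ := hE.action
    have hsm : sMass (fun _ : Fin 1 => W 0) = fun x => ‖W 0 x‖ := by
      funext x; simp [sMass]
    rw [hsm]
    exact (hM 0).1
  · obtain ⟨σ₀, P, hP⟩ := hE.bdd 0
    refine ⟨σ₀, P, fun x hx => ?_⟩
    unfold wEnergy sEnergy
    simp only [Finset.univ_unique, Fin.default_eq_zero, Finset.sum_singleton, mul_one]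
    exact hP x hx

/-- **The rung on the dyadic member ⟺ no scalar fronts.**  The statement of the registered rung
`stub_rung_dss` with the table fixed to `dyadicTable` (uniform-fraction tail ratchet along every uniformly
bounded admissible inviscid shell-self-similar eternal solution of the dyadic member, below a threshold) holds
if and only if the construction `DyadicScalarFronts` fails.
[cite: Tao2016AveragedNS, §1.2, §4; cell vocabulary (stmt-NavierStokesRegularity-21808, line `birth`)] -/
theorem dyadicRung_iff_not_DyadicScalarFronts :
    (∃ w : ℝ, 0 < w ∧ ∃ εs : ℝ, 0 < εs ∧ ∀ ε₀ : ℝ, 0 < ε₀ → ε₀ ≤ εs →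
      ∀ (W : ℤ → ℝ → Em 4) (T : ℝ), IsEternal ε₀ dyadicTable W → UniformBound W →
        (∀ (n : ℤ) (σ : ℝ), W (n + 1) σ = W n (σ - T)) →
        ∀ (n : ℤ) (M : ℝ), (∀ σ : ℝ, ∑' k : ℕ, physEnergy ε₀ W (n + k) σ ≤ M) →
          ∀ σ : ℝ, ∑' k : ℕ, physEnergy ε₀ W (n + 1 + k) σ ≤ (1 - w) * M)
      ↔ ¬ DyadicScalarFronts := by
  have hc : IsCancellingCoeff dyadicTable := (inTableClass_dyadicTable le_rfl).2.1
  constructor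
  · -- fronts at arbitrarily small `ε₀` kill the dyadic rung
    rintro ⟨w, hw, εs, hεs, H⟩ hF
    set w' : ℝ := min w (1 / 2) with hw'
    have hw'1 : w' ≤ 1 := (min_le_right _ _).trans (by norm_num)
    have hw'0 : 0 < w' := lt_min hw (by norm_num)
    obtain ⟨ε₀, hε₀, hle, T, Φ, hW, x, hne⟩ :=
      DyadicScalarFronts_iff.1 hF (min εs (w' / 5)) (lt_min hεs (by positivity))
    have hthr : (1 + ε₀) ^ 5 * (1 - w') ≤ 1 :=
      pow_five_mul_sub_le_one hw'1 hε₀.le (hle.trans (min_le_right _ _))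
    have hD : ∀ (n : ℤ) (σ : ℝ), dssEmbed (1 : Equiv.Perm (Fin 1)) T Φ 0 (n + (1 : ℕ)) σ
        = dssEmbed (1 : Equiv.Perm (Fin 1)) T Φ 0 n (σ - T) := by
      intro n σ
      rw [embed_apply, embed_apply]
      congr 1
      push_cast
      ring
    have hD' : ∀ (n : ℤ) (σ : ℝ), dssEmbed (1 : Equiv.Perm (Fin 1)) T Φ 0 (n + 1) σ
        = dssEmbed (1 : Equiv.Perm (Fin 1)) T Φ 0 n (σ - T) := fun n σ => by
      simpa using hD n σ
    have hEt := hW.isEternal_dssEmbed 0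
    have hUt := uniformBound_dssEmbed hW 0
    have hC : ∀ (n : ℤ) (M : ℝ),
        (∀ σ : ℝ, ∑' k : ℕ, physEnergy ε₀ (dssEmbed (1 : Equiv.Perm (Fin 1)) T Φ 0) (n + k) σ ≤ M) →
        ∀ σ : ℝ, ∑' k : ℕ, physEnergy ε₀ (dssEmbed (1 : Equiv.Perm (Fin 1)) T Φ 0) (n + 1 + k) σ
          ≤ (1 - w') * M := by
      intro n M hM σ
      have hM0 : 0 ≤ M := (tsum_nonneg fun k : ℕ =>
        physEnergy_nonneg ε₀ (dssEmbed (1 : Equiv.Perm (Fin 1)) T Φ 0) (n + (k : ℤ)) σ).trans (hM σ)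
      have h1 := H ε₀ hε₀ (hle.trans (min_le_left _ _)) _ T hEt hUt hD' n M hM σ
      exact h1.trans (mul_le_mul_of_nonneg_right (by linarith [min_le_left w (1 / 2)]) hM0)
    have h0 := trivial_of_contraction hε₀ hc hEt hUt hW.delay_pos hw'1 hthr hD hC 0 x
    rw [embed_apply, Int.cast_zero, zero_mul, sub_zero] at h0
    exact hne h0
  · -- no fronts below `ε` ⟹ every shell-self-similar bounded admissible eternal solution below `ε` is zero
    intro hF
    have hF' := hF
    unfold DyadicScalarFronts at hF'
    push Not at hF'
    obtain ⟨ε, hε, hnone⟩ := hF'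
    refine ⟨1 / 2, by norm_num, ε, hε, ?_⟩
    intro ε₀ hε₀ hle W T hE hU hD n M hM σ
    have hzero : ∀ (k : ℤ) (s : ℝ), W k s = 0 := by
      rcases lt_or_ge 0 T with hT | hT
      · have hW := isDSSWave_of_shellSelfSimilar hT hE hD
        have h0 : ∀ x, W 0 x = 0 := by
          intro x
          by_contra hx
          have hs : 1 < Real.exp T := by rw [← Real.exp_zero]; exact Real.exp_lt_exp.2 hT
          obtain ⟨t, ht, hat⟩ := front_ne_zero hε₀ hW (x := x) hx
          exact hat (hnone ε₀ hε₀ hle (Real.exp T) hs _ (fun t ht => front_hasDerivAt hε₀ hW t ht)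
            (front_integrableOn hε₀ hW) (front_bdd hε₀ hW) t ht)
        exact eq_zero_of_shell_zero hD h0
      · exact eq_zero_of_dss_nonpos_lag hε₀ hc hE.isEternalVisc hU hT hD
    have hM0 : 0 ≤ M :=
      (tsum_nonneg fun k : ℕ => physEnergy_nonneg ε₀ W (n + (k : ℤ)) σ).trans (hM σ)
    have hsum : ∑' k : ℕ, physEnergy ε₀ W (n + 1 + k) σ = 0 := by
      have : (fun k : ℕ => physEnergy ε₀ W (n + 1 + k) σ) = fun _ => 0 := by
        funext k; simp [physEnergy, hzero]
      rw [this, tsum_zero]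
    rw [hsum]
    exact mul_nonneg (by norm_num) hM0

/-- **Corollary: the two registered inviscid stubs of the line `birth`, read on the dyadic member, are decided
by the construction item alone** — `DyadicScalarFronts` refutes them (`WakeRatchetBirthStubs`), and its
failure proves the dyadic rung (vacuously: a Liouville statement). [cite: Tao2016AveragedNS, §1.2, §4; cell vocabulary] -/
theorem dyadicRung_of_not_DyadicScalarFronts (hF : ¬ DyadicScalarFronts) :
    ∃ w : ℝ, 0 < w ∧ ∃ εs : ℝ, 0 < εs ∧ ∀ ε₀ : ℝ, 0 < ε₀ → ε₀ ≤ εs →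
      ∀ (W : ℤ → ℝ → Em 4) (T : ℝ), IsEternal ε₀ dyadicTable W → UniformBound W →
        (∀ (n : ℤ) (σ : ℝ), W (n + 1) σ = W n (σ - T)) →
        ∀ (n : ℤ) (M : ℝ), (∀ σ : ℝ, ∑' k : ℕ, physEnergy ε₀ W (n + k) σ ≤ M) →
          ∀ σ : ℝ, ∑' k : ℕ, physEnergy ε₀ W (n + 1 + k) σ ≤ (1 - w) * M :=
  dyadicRung_iff_not_DyadicScalarFronts.2 hF

end WakeRatchetDyadicRung

end Summit.NavierStokesRegularity.NavierStokesRegularity.Theorems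

end
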